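import Literature.AlgebraicGeometry.Surfaces.K3PeriodSurjectivity
import Literature.AlgebraicGeometry.HodgeTheory.DirectImageTransport
import Literature.AlgebraicGeometry.HodgeTheory.HyperplaneSectionLocalSystem
import HarnessLib

/-!
# Lattice-polarised families of K3 surfaces and threefolds fibred by them
# (Doran–Harder–Novoseltsev–Thompson, Math. Z. 294 (2019), Def. 2.1 and §2.2; IMRN 2015, §2.1)

Family `hodge`, layer `Literature/AlgebraicGeometry/Surfaces`. Definition request
`defn-LatticePolarizedK3Fibration` (route `HodgeConjecture/SecondaryPeriods`, rev 5, D1): the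
carrier for its informal cruxes `TorsionValuesAtCMFibres` / `TorsionValuesAtRationalFibres` (a
threefold `Y → ℙ¹` fibred by `M_n`-polarised K3 surfaces `D_t`, `ρ(D_t) = 19`, `T(D_t)`, `𝒯`).

## Sources (held texts `paper:arxiv-1701.03279` chunks p0005–p0007, `paper:arxiv-1312.6434` p0005)

* DHNT 2019, §2: "`M_n := H ⊕ E₈ ⊕ E₈ ⊕ ⟨−2n⟩` (here `H` denotes the hyperbolic plane lattice
  and `E₈` denotes the negative definite `E₈` root lattice)". **Definition 2.1**: "Let `L ⊆ Λ_{K3}`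
  be a lattice and `π^U : 𝒳^U → U` be a smooth projective family of K3 surfaces over a smooth
  quasiprojective base `U`. We say that `𝒳^U` is an `L`-polarized family of K3 surfaces if there
  is a trivial local subsystem `ℒ` of `R²π_*ℤ` so that, for each `p ∈ U`, the fibre
  `ℒ_p ⊆ H²(X_p, ℤ)` of `ℒ` over `p` is a primitive sublattice of `NS(X_p)` that is isomorphic to
  `L` and contains an ample divisor class." Then: "we will call such `𝒳` a threefold fibred by
  `M_n`-polarized K3 surfaces. If, in addition, the family `π^U` is not isotrivial, … fibred
  non-isotrivially". §2.2, eq. (2.3): "`R²π^U_*ℚ = (𝒩𝒮(𝒳^U) ⊕ 𝒯(𝒳^U)) ⊗ ℚ` … two irreducible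
  `ℚ`-local systems. Here `𝒩𝒮(𝒳^U)` can be interpreted as those classes which lie in `NS(X_p)`
  for all `p ∈ U`; by assumption, in our setting `𝒩𝒮(𝒳^U)` is a trivial local system of rank 19."
* DHNT 2015, §2.1: `NS(X) ⊂ H²(X, ℤ)`, "the lattice of cycles orthogonal to `NS(X)` is called the
  lattice of transcendental cycles … `T(X)`"; `𝒩𝒮(𝒳) = ω_𝒳^⊥ ⊆ R²π_*ℤ`, "`𝒯(𝒳)` the integral
  orthogonal complement of `𝒩𝒮(𝒳)`", `R²π_*ℚ = (𝒯 ⊕ 𝒩𝒮) ⊗ ℚ`; Def. 2.1: "`𝒳` is `N`-polarized if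
  the local system `𝒩` is a trivial local system" (`𝒩_p ≅ N` primitive in `H²(X_p, ℤ)`,
  "containing the Chern class of the ample line bundle").

## Rendering (real carriers: `complexBetti`, `IsIntegralClass`, `algebraicClasses`, `cupProduct`;
the local system `R²π_*ℂ|_U` with its transport `transportFun` of `HodgeTheory/DirectImageTransport`,
built from `IsCohomologicallyLocallyTrivialOn π U` — Ehresmann's conclusion, a field here as there)

* `latticeMnGram n`: Gram matrix of `M_n = H ⊕ E₈(−1)² ⊕ ⟨−2n⟩` (`hyperbolicPlaneGram`,
  `CartanMatrix.E₈` as in `K3PeriodSurjectivity`). `neronSeveriGroup S`: the INTEGRAL classes in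
  the span `algebraicClasses S 1` of divisor classes (`NS` of a K3 is primitive in `H²(S, ℤ)`, so
  this is the image of `NS(S)`); `transcendentalSubspace S = NS(S)^⊥` (`= T(S) ⊗ ℂ`).
* `LatticePolarization π U G` (Def. 2.1) for `π : Y ⟶ B`, `U ⊆ B(ℂ)`, `G` the Gram matrix of `L`:
  K3 fibres over `U`; `ℒ` GIVEN BY A FLAT INTEGRAL BASIS `cls i s ∈ H²(X_s(ℂ); ℂ)` (a trivial
  local system of fibre `L` = `rank L` flat sections forming a basis of each fibre) of
  Néron–Severi classes, `ℤ`-independent, Gram matrix `G` relative to the POSITIVE generator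
  `top s` of `H⁴(X_s(ℂ); ℤ)` (pinned by the degree of a hyperplane section, so `ℒ_s ≅ L`, not
  `L(−1)`), `ℒ_s` primitive, and — "contains an ample divisor class" — `ℒ_s` contains the
  pull-back of a non-zero integral class of `H²(ℙᴺ)` along a closed immersion `X_s ↪ ℙᴺ` (an
  integral multiple of a very ample class; as `ℒ_s ∋ ±it` is primitive this is equivalent to
  containing an ample class, `mA` being very ample for `A` ample, `m ≫ 0`).
* `LatticePolarization.transcendental s = ℒ_s^⊥` and the sub-local system
  `transcendentalLocalSystem ⊆ R²π_*ℂ|_U` (transport preserves `ℒ` and cup products): DHNT's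
  `𝒯(𝒳^U) ⊗ ℂ` EXACTLY WHEN `𝒩𝒮(𝒳^U) = ℒ`, i.e. when `NS` of the general fibre is `L` — the
  standing hypothesis of DHNT Thm. 2.2 / Lemma 2.5 / Prop. 2.6, here `HasGenericNS` ("general"
  read as off a countable set: the Noether–Lefschetz locus is countable, possibly dense);
  `IsNSGeneric s`: `NS(X_s) = ℒ_s` (`ρ(X_s) = rank L`, the fibres the route evaluates at).
* `LatticePolarizedK3Fibration π G`: `Y` a smooth projective threefold, `B` a smooth projective
  curve (`Motives.projectiveSpace 1 ℂ` for the route), `U ⊆ B(ℂ)` the non-empty set of complex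
  points off a proper Zariski-closed subset, and an `L`-polarisation over `U` (the smooth setting
  of Lemma 2.5). `IsFibrewiseIsotrivialOn π U`: all fibres over `U` are isomorphic (implied by
  isotriviality; negated, it is the strong form of "non-isotrivial").
* Named fact `DHNT2019_monodromyInvariants_le_span` (§2.2 (2.3)): non-isotrivial, `NS` of the
  general fibre `= L` ⟹ the monodromy invariants of `H²(X_s(ℂ); ℂ)` lie in `ℒ_s ⊗ ℂ`. PROVED:
  `ℒ_s ⊗ ℂ ⊆` invariants, `Im(H²(Y) → H²(X_s)) ⊆` invariants (easy half of the invariant cycle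
  theorem, `transportFun_map_fiberι`); the hard half is `HodgeTheory.deligne_globalInvariantCycles`.

NOT here: DHNT Thm. 2.2 / Prop. 2.6 (no carrier for `𝓜_{M_n}`, the modular family, `𝕍_n^+`);
Zucker's Hodge structure on `H¹(B, j_*𝒯)` and Lemma 2.5 (separate file); `(N, G)`-polarisations.

## References

* [DoranHarderNovoseltsevThompson2019] Doran–Harder–Novoseltsev–Thompson, Math. Z. 294 (2019),
  §2 Def. 2.1, §2.2 eq. (2.3). * [DoranEtAl2015] —, IMRN 2015, §2.1 and Def. 2.1.
* [Dolgachev1996] I. V. Dolgachev, J. Math. Sci. 81 (1996) (lattice-polarised K3 surfaces, `M_n`).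
* [Huybrechts2016K3] D. Huybrechts, Lectures on K3 Surfaces, Ch. 1 Prop. 3.5, Ch. 3 §3.
* [VoisinHodgeI2002] C. Voisin, Hodge Theory and Complex Algebraic Geometry I, §9.2.1.
-/

noncomputable section

open CategoryTheory AlgebraicGeometry
open Literature.AlgebraicTopology.SingularHomology

namespace Literature.AlgebraicGeometry.Surfaces

/-! ### The lattices `M_n = H ⊕ E₈(−1) ⊕ E₈(−1) ⊕ ⟨−2n⟩` -/

/-- Index set of a basis of `M_n = H ⊕ E₈ ⊕ E₈ ⊕ ⟨−2n⟩` (rank `2 + 8 + 8 + 1 = 19`).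
[cite: DoranHarderNovoseltsevThompson2019, §2 (p. 4, definition of M_n)] -/
abbrev MnIndex : Type := Fin 2 ⊕ ((Fin 8 ⊕ Fin 8) ⊕ Fin 1)

/-- **The Gram matrix of `M_n := H ⊕ E₈ ⊕ E₈ ⊕ ⟨−2n⟩`** ("`H` denotes the hyperbolic plane
lattice and `E₈` denotes the negative definite `E₈` root lattice"): block-diagonal with blocks
`!![0,1;1,0]`, `−E₈`, `−E₈` (Mathlib's Cartan matrix, negated), `(−2n)`; rank `19`, signature
`(1, 18)`. [cite: DoranHarderNovoseltsevThompson2019, §1 and §2 (definition of M_n)] [cite: Dolgachev1996, §7] -/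
def latticeMnGram (n : ℕ) : Matrix MnIndex MnIndex ℤ :=
  Matrix.fromBlocks hyperbolicPlaneGram 0 0
    (Matrix.fromBlocks (Matrix.fromBlocks (-CartanMatrix.E₈) 0 0 (-CartanMatrix.E₈)) 0 0
      (Matrix.of fun _ _ => -(2 * (n : ℤ))))

/-- `M_n` has rank `19`. [cite: DoranHarderNovoseltsevThompson2019, §1] -/
theorem card_mnIndex : Fintype.card MnIndex = 19 := by simp

/-- The Gram matrix of `M_n` is symmetric. [folklore] -/
theorem latticeMnGram_transpose (n : ℕ) : (latticeMnGram n).transpose = latticeMnGram n := by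
  simp only [latticeMnGram, Matrix.fromBlocks_transpose, Matrix.transpose_zero,
    Matrix.transpose_neg, CartanMatrix.E₈_transpose]
  congr 1
  · simp only [hyperbolicPlaneGram]; decide

/-! ### Néron–Severi and transcendental classes of one surface, on the real carriers -/

section Single

variable (S : Motives.SchemeOver ℂ)

/-- **The Néron–Severi group `NS(S) ⊂ H²(S(ℂ); ℂ)`** on the real carriers: the integral classes
in the `ℂ`-span `algebraicClasses S 1` of the divisor classes ("the Néron-Severi group of divisors
modulo homological equivalence on `X` forms a non-degenerate lattice inside of `H²(X, ℤ)`"; for a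
K3 surface `NS(X)` is primitive in `H²(X, ℤ)`, Huybrechts Ch. 1 §3.3, so no saturation occurs).
[cite: DoranEtAl2015, §2 (first paragraph)] [cite: Huybrechts2016K3, Ch. 1 Prop. 3.5 and §3.3] -/
def neronSeveriGroup : AddSubgroup (HodgeTheory.complexBetti S (2 * 1)) where
  carrier := {c | HodgeTheory.IsIntegralClass c ∧ c ∈ HodgeTheory.algebraicClasses S 1}
  add_mem' := fun ha hb => ⟨ha.1.add hb.1, add_mem ha.2 hb.2⟩
  zero_mem' := ⟨HodgeTheory.IsIntegralClass.zero, zero_mem _⟩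
  neg_mem' := fun {c} hc => ⟨by simpa using hc.1.zsmul (-1), neg_mem hc.2⟩

/-- Membership in `NS(S)`, unfolded. [cite: DoranEtAl2015, §2] -/
theorem mem_neronSeveriGroup_iff (c : HodgeTheory.complexBetti S (2 * 1)) :
    c ∈ neronSeveriGroup S ↔
      HodgeTheory.IsIntegralClass c ∧ c ∈ HodgeTheory.algebraicClasses S 1 :=
  Iff.rfl

/-- **The transcendental subspace `T(S) ⊗ ℂ = NS(S)^⊥ ⊂ H²(S(ℂ); ℂ)`**: the classes cup-orthogonal
to `NS(S)` in `H⁴(S(ℂ); ℂ)` ("The lattice of cycles orthogonal to `NS(X)` is called the lattice of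
transcendental cycles on `X` and is denoted `T(X)`"). [cite: DoranEtAl2015, §2 (first paragraph)]
[cite: Huybrechts2016K3, Ch. 3 Lemma 3.1] -/
def transcendentalSubspace : Submodule ℂ (HodgeTheory.complexBetti S (2 * 1)) :=
  ⨅ (c : HodgeTheory.complexBetti S (2 * 1)) (_ : c ∈ neronSeveriGroup S),
    LinearMap.ker (cupProduct (R := ℂ) (rfl : 2 * 1 + 2 * 1 = 2 * 2) c)

/-- Membership in `T(S) ⊗ ℂ`: orthogonality to every Néron–Severi class. [cite: DoranEtAl2015, §2] -/
theorem mem_transcendentalSubspace_iff (x : HodgeTheory.complexBetti S (2 * 1)) :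
    x ∈ transcendentalSubspace S ↔
      ∀ c ∈ neronSeveriGroup S, cupProduct (rfl : 2 * 1 + 2 * 1 = 2 * 2) c x = 0 := by
  simp [transcendentalSubspace, Submodule.mem_iInf]

end Single

/-! ### Lattice-polarised families (DHNT Def. 2.1) -/

/-- **`L`-polarised family of K3 surfaces over `U`** (DHNT 2019, Def. 2.1; DHNT 2015, §2.1 and
Def. 2.1), on the real carriers, for `π : Y ⟶ B`, a subset `U ⊆ B(ℂ)` of complex points and the
Gram matrix `G` of `L` on a basis indexed by `ι`. Fields: `π` is cohomologically locally trivial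
over `U` (Ehresmann; makes `R²π_*ℂ|_U` a local system, `HodgeTheory/DirectImageCovering`) with K3
fibres; the trivial local subsystem `ℒ ⊆ R²π_*ℤ|_U` is given by a FLAT basis of INTEGRAL classes
`cls i s ∈ H²(X_s(ℂ); ℂ)` of Néron–Severi classes, `ℤ`-independent, with Gram matrix `G`
("isomorphic to `L`") relative to the positive generator `top s` of `H⁴(X_s(ℂ); ℤ)`; `ℒ_s` is
primitive; and `ℒ_s` contains an ample class, rendered as: an integral multiple `e^*η` of a
hyperplane-section class (`e : X_s ↪ ℙᴺ` a closed immersion, `η ∈ H²(ℙᴺ(ℂ); ℤ)`) of positive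
degree `(e^*η)² = d · top s`, `d > 0`, lies in `ℒ_s` (module docstring).
[cite: DoranHarderNovoseltsevThompson2019, Definition 2.1] [cite: DoranEtAl2015, §2.1 and Definition 2.1] -/
structure LatticePolarization {Y B : Motives.SchemeOver ℂ} (π : Y ⟶ B)
    (U : Set (Motives.ComplexPoints B)) {ι : Type} [Fintype ι] (G : Matrix ι ι ℤ) : Type where
  /-- `π` is cohomologically locally trivial over `U` (conclusion of Ehresmann's theorem). -/
  locTriv : HodgeTheory.IsCohomologicallyLocallyTrivialOn π U
  /-- The fibres over `U` are K3 surfaces. -/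
  isK3 : ∀ s : U, IsK3Surface (Motives.fiberOver π s.1)
  /-- The flat basis `λ_i(s)` of the fibres `ℒ_s` of the trivial local subsystem `ℒ`. -/
  cls : ι → ∀ s : U, HodgeTheory.complexBetti (Motives.fiberOver π s.1) (2 * 1)
  /-- The positive generator of `H⁴(X_s(ℂ); ℤ) ≅ ℤ`. -/
  top : ∀ s : U, HodgeTheory.complexBetti (Motives.fiberOver π s.1) (2 * 2)
  /-- `top s` is integral … -/
  top_isIntegralClass : ∀ s : U, HodgeTheory.IsIntegralClass (top s)
  /-- … and generates the integral classes of `H⁴(X_s(ℂ); ℂ)`. -/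
  top_generates : ∀ (s : U) (q : HodgeTheory.complexBetti (Motives.fiberOver π s.1) (2 * 2)),
    HodgeTheory.IsIntegralClass q → ∃ n : ℤ, q = n • top s
  /-- The classes `λ_i(s)` are integral … -/
  cls_isIntegralClass : ∀ (i : ι) (s : U), HodgeTheory.IsIntegralClass (cls i s)
  /-- … Néron–Severi (in the span of the divisor classes) … -/
  cls_mem_algebraicClasses : ∀ (i : ι) (s : U),
    cls i s ∈ HodgeTheory.algebraicClasses (Motives.fiberOver π s.1) 1
  /-- … flat (`ℒ` is a local subsystem, trivialised by the `λ_i`) … -/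
  transportFun_cls : ∀ (i : ι) (s t : U) (γ : Path.Homotopic.Quotient s t),
    HodgeTheory.transportFun π (2 * 1) locTriv γ (cls i s) = cls i t
  /-- … `ℤ`-linearly independent … -/
  linearIndependent_cls : ∀ s : U, LinearIndependent ℤ fun i => cls i s
  /-- … with Gram matrix `G`: `λ_i(s) ∪ λ_j(s) = G i j · top s` (`ℒ_s ≅ L`). -/
  cupProduct_cls : ∀ (i j : ι) (s : U),
    cupProduct (rfl : 2 * 1 + 2 * 1 = 2 * 2) (cls i s) (cls j s) = (G i j : ℂ) • top s
  /-- `ℒ_s` is primitive: an integral class with a non-zero multiple in `ℒ_s` lies in `ℒ_s`. -/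
  primitive : ∀ (s : U) (c : HodgeTheory.complexBetti (Motives.fiberOver π s.1) (2 * 1)) (m : ℤ),
    m ≠ 0 → HodgeTheory.IsIntegralClass c → m • c ∈ Submodule.span ℤ (Set.range fun i => cls i s) →
      c ∈ Submodule.span ℤ (Set.range fun i => cls i s)
  /-- `ℒ_s` contains an ample class: an integral multiple `e^*η` of a hyperplane-section class,
  of positive degree `(e^*η)² = d · top s` (this also pins `top s` to the orientation class). -/
  ample : ∀ s : U, ∃ (N : ℕ) (e : Motives.fiberOver π s.1 ⟶ Motives.projectiveSpace N ℂ)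
      (η : HodgeTheory.complexBetti (Motives.projectiveSpace N ℂ) (2 * 1)) (d : ℤ),
    IsClosedImmersion e.left ∧ HodgeTheory.IsIntegralClass η ∧ 0 < d ∧
      cupProduct (rfl : 2 * 1 + 2 * 1 = 2 * 2) (HodgeTheory.complexBetti.map e (2 * 1) η)
        (HodgeTheory.complexBetti.map e (2 * 1) η) = d • top s ∧
      HodgeTheory.complexBetti.map e (2 * 1) η ∈ Submodule.span ℤ (Set.range fun i => cls i s)

namespace LatticePolarization

variable {Y B : Motives.SchemeOver ℂ} {π : Y ⟶ B} {U : Set (Motives.ComplexPoints B)}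
  {ι : Type} [Fintype ι] {G : Matrix ι ι ℤ} (P : LatticePolarization π U G)

/-- The polarised locus `U` is open in `B(ℂ)` (cohomological local triviality forces it).
[cite: VoisinHodgeI2002, §9.2.1] -/
theorem isOpen (P : LatticePolarization π U G) : IsOpen U := P.locTriv.isOpen

/-- **The lattice `ℒ_s ⊂ H²(X_s(ℂ); ℂ)`**: the `ℤ`-span of the flat basis `λ_i(s)` (the fibre of
the trivial local subsystem `ℒ`, `≅ L`). [cite: DoranHarderNovoseltsevThompson2019, Definition 2.1] -/
def lattice (s : U) : Submodule ℤ (HodgeTheory.complexBetti (Motives.fiberOver π s.1) (2 * 1)) :=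
  Submodule.span ℤ (Set.range fun i => P.cls i s)

/-- **`ℒ_s ⊗ ℂ`**: the `ℂ`-span of the polarising classes. [cite: DoranHarderNovoseltsevThompson2019, Definition 2.1] -/
def span (s : U) : Submodule ℂ (HodgeTheory.complexBetti (Motives.fiberOver π s.1) (2 * 1)) :=
  Submodule.span ℂ (Set.range fun i => P.cls i s)

/-- **`𝒯_s ⊗ ℂ := ℒ_s^⊥ ⊂ H²(X_s(ℂ); ℂ)`**, the orthogonal complement of the polarisation for the
cup product; DHNT's transcendental local system `𝒯(𝒳^U)` ("the integral orthogonal complement of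
`𝒩𝒮(𝒳^U)`") when `𝒩𝒮(𝒳^U) = ℒ`, i.e. under `HasGenericNS` (module docstring).
[cite: DoranHarderNovoseltsevThompson2019, §2.2] [cite: DoranEtAl2015, §2.1] -/
def transcendental (s : U) :
    Submodule ℂ (HodgeTheory.complexBetti (Motives.fiberOver π s.1) (2 * 1)) :=
  ⨅ i : ι, LinearMap.ker (cupProduct (R := ℂ) (rfl : 2 * 1 + 2 * 1 = 2 * 2) (P.cls i s))

/-- Membership in `𝒯_s ⊗ ℂ`: orthogonality to the polarising classes. [cite: DoranEtAl2015, §2.1] -/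
theorem mem_transcendental_iff (s : U) (x : HodgeTheory.complexBetti (Motives.fiberOver π s.1) (2 * 1)) :
    x ∈ P.transcendental s ↔
      ∀ i, cupProduct (rfl : 2 * 1 + 2 * 1 = 2 * 2) (P.cls i s) x = 0 := by
  simp [transcendental, Submodule.mem_iInf]

/-- **The monodromy invariants `H²(X_s(ℂ); ℂ)^{π₁(U, s)}`**: classes fixed by transport along every
loop at `s` in `U`. [cite: DoranEtAl2015, §2.2] -/
def invariants (s : U) : Submodule ℂ (HodgeTheory.complexBetti (Motives.fiberOver π s.1) (2 * 1)) :=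
  ⨅ γ : Path.Homotopic.Quotient s s,
    (HodgeTheory.transportLinear π (2 * 1) P.locTriv γ).eqLocus LinearMap.id

/-- Membership in the invariants, unfolded. [cite: DoranEtAl2015, §2.2] -/
theorem mem_invariants_iff (s : U) (x : HodgeTheory.complexBetti (Motives.fiberOver π s.1) (2 * 1)) :
    x ∈ P.invariants s ↔
      ∀ γ : Path.Homotopic.Quotient s s, HodgeTheory.transportFun π (2 * 1) P.locTriv γ x = x := by
  simp [invariants, Submodule.mem_iInf, LinearMap.mem_eqLocus]

/-- The polarising classes are Néron–Severi classes: `ℒ_s ⊆ NS(X_s)`.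
[cite: DoranHarderNovoseltsevThompson2019, Definition 2.1] -/
theorem lattice_le_neronSeveriGroup (s : U)
    {c : HodgeTheory.complexBetti (Motives.fiberOver π s.1) (2 * 1)} (hc : c ∈ P.lattice s) :
    c ∈ neronSeveriGroup (Motives.fiberOver π s.1) := by
  refine Submodule.span_induction (p := fun c _ => c ∈ neronSeveriGroup (Motives.fiberOver π s.1))
    ?_ (zero_mem _) (fun _ _ _ _ hx hy => add_mem hx hy) (fun m x _ hx => ?_) hc
  · rintro _ ⟨i, rfl⟩
    exact ⟨P.cls_isIntegralClass i s, P.cls_mem_algebraicClasses i s⟩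
  · exact zsmul_mem hx m

/-- Transport along paths in `U` maps `ℒ_s ⊗ ℂ` into `ℒ_t ⊗ ℂ` (the basis is flat).
[cite: DoranHarderNovoseltsevThompson2019, Definition 2.1] -/
theorem transportFun_mem_span {s t : U} (γ : Path.Homotopic.Quotient s t)
    {x : HodgeTheory.complexBetti (Motives.fiberOver π s.1) (2 * 1)} (hx : x ∈ P.span s) :
    HodgeTheory.transportFun π (2 * 1) P.locTriv γ x ∈ P.span t := by
  rw [← HodgeTheory.transportLinear_apply]
  refine (Submodule.span_le.2 ?_ : P.span s ≤ (P.span t).comap _) hx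
  rintro _ ⟨i, rfl⟩
  simp only [SetLike.mem_coe, Submodule.mem_comap, HodgeTheory.transportLinear_apply,
    P.transportFun_cls]
  exact Submodule.subset_span ⟨i, rfl⟩

/-- Transport along paths in `U` maps `𝒯_s ⊗ ℂ` into `𝒯_t ⊗ ℂ` (it is multiplicative for the cup
product and fixes the flat basis of `ℒ`). [cite: DoranEtAl2015, §2.2] -/
theorem transportFun_mem_transcendental {s t : U} (γ : Path.Homotopic.Quotient s t)
    {x : HodgeTheory.complexBetti (Motives.fiberOver π s.1) (2 * 1)} (hx : x ∈ P.transcendental s) :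
    HodgeTheory.transportFun π (2 * 1) P.locTriv γ x ∈ P.transcendental t := by
  rw [mem_transcendental_iff] at hx ⊢
  intro i
  rw [← P.transportFun_cls i s t γ, ← HodgeTheory.transportFun_cupProduct π P.locTriv, hx i,
    ← HodgeTheory.transportLinear_apply, map_zero]

/-- Transport fixes every class of `ℒ_s ⊗ ℂ` along loops: `ℒ_s ⊗ ℂ ⊆ H²(X_s)^{π₁}`.
[cite: DoranHarderNovoseltsevThompson2019, Definition 2.1] -/
theorem span_le_invariants (s : U) : P.span s ≤ P.invariants s := by
  refine Submodule.span_le.2 ?_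
  rintro _ ⟨i, rfl⟩
  simp only [SetLike.mem_coe, mem_invariants_iff, P.transportFun_cls, implies_true]

/-- **Restrictions of global classes are monodromy invariant**: `A|_{X_s} ∈ H²(X_s)^{π₁}` for
`A ∈ H²(Y(ℂ); ℂ)` — the easy inclusion of the global invariant cycle theorem (the hard one is
`HodgeTheory.deligne_globalInvariantCycles`). [cite: VoisinHodgeII2003, §3.1.2] -/
theorem map_fiberι_mem_invariants (s : U) (A : HodgeTheory.complexBetti Y (2 * 1)) :
    HodgeTheory.complexBetti.map (Motives.fiberι π s.1) (2 * 1) A ∈ P.invariants s :=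
  (P.mem_invariants_iff s _).2 fun γ => HodgeTheory.transportFun_map_fiberι π (2 * 1) P.locTriv γ A

/-- **The polarising local system `ℒ ⊗ ℂ ⊆ R²π_*ℂ|_U`** as a sub-local system of the local system
`localSystemOfRestrict π 2` on the real carriers. [cite: DoranHarderNovoseltsevThompson2019, Definition 2.1] -/
def polarizingLocalSystem : Motives.LocalSystem ℂ U :=
  (HodgeTheory.localSystemOfRestrict π (2 * 1) P.locTriv).subsystem (fun s => P.span s)
    fun _ _ γ _ hx => P.transportFun_mem_span γ hx

/-- **The transcendental local system `𝒯 ⊗ ℂ ⊆ R²π_*ℂ|_U`** (stalks `ℒ_s^⊥`), a sub-local system of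
`localSystemOfRestrict π 2`; DHNT's `𝒯(𝒳^U) ⊗ ℂ` under `HasGenericNS`.
[cite: DoranHarderNovoseltsevThompson2019, §2.2] [cite: DoranEtAl2015, §2.1] -/
def transcendentalLocalSystem : Motives.LocalSystem ℂ U :=
  (HodgeTheory.localSystemOfRestrict π (2 * 1) P.locTriv).subsystem (fun s => P.transcendental s)
    fun _ _ γ _ hx => P.transportFun_mem_transcendental γ hx

/-- **`NS(X_s) = ℒ_s`** ("the Néron–Severi group of a general fibre is isomorphic to `L`", at the
fibre `X_s`; equivalently `ρ(X_s) = rank L`, as `ℒ_s ⊆ NS(X_s)` is primitive): every Néron–Severi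
class of `X_s` lies in `ℒ_s`. [cite: DoranHarderNovoseltsevThompson2019, Theorem 2.2 and Lemma 2.5 (hypothesis)] -/
def IsNSGeneric (s : U) : Prop :=
  ∀ c ∈ neronSeveriGroup (Motives.fiberOver π s.1), c ∈ P.lattice s

/-- **"The Néron–Severi group of a general fibre is `L`"** (standing hypothesis of DHNT §2, Thm. 2.2,
Lemma 2.5, Prop. 2.6), with "general" read as "off a countable subset of `U`" (the jumping locus
of the Picard number is a countable union of points of the curve `U`, possibly dense).
[cite: DoranHarderNovoseltsevThompson2019, §2 (standing assumption) and Theorem 2.2] -/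
def HasGenericNS (P : LatticePolarization π U G) : Prop :=
  Set.Countable {s : U | ¬ P.IsNSGeneric s}

end LatticePolarization

/-! ### Threefolds fibred by lattice-polarised K3 surfaces -/

/-- **Fibrewise isotriviality over `U`**: any two fibres over points of `U` are isomorphic as
`ℂ`-schemes (a consequence of isotriviality of `π^U`; DHNT: "If, in addition, the family `π^U` is
not isotrivial, we will call `𝒳` a threefold fibred non-isotrivially"). Its negation is the form in
which non-isotriviality is consumed below. [cite: DoranHarderNovoseltsevThompson2019, §2 (after Definition 2.1)] -/
def IsFibrewiseIsotrivialOn {Y B : Motives.SchemeOver ℂ} (π : Y ⟶ B)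
    (U : Set (Motives.ComplexPoints B)) : Prop :=
  ∀ s ∈ U, ∀ t ∈ U, Nonempty (Motives.fiberOver π s ≅ Motives.fiberOver π t)

/-- **Threefold fibred by `L`-polarised K3 surfaces** (DHNT 2019, §2, in the smooth setting of
Lemma 2.5: "Let `π : 𝒳 → B` be a smooth threefold and suppose that the restriction `π^U` of `π` to
a Zariski open set `U ⊂ B` is an `L`-polarized family of K3 surfaces"): `Y` a smooth projective
threefold, `B` a smooth projective curve (`ℙ¹ = Motives.projectiveSpace 1 ℂ` in the route's
pencils), `π : Y ⟶ B`, `U ⊆ B(ℂ)` the (non-empty) set of complex points off a proper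
Zariski-closed subset of `B`, and an `L`-polarisation of `π` over `U` (`LatticePolarization`,
Gram matrix `G` of `L`).
[cite: DoranHarderNovoseltsevThompson2019, §2 Definition 2.1 and Lemma 2.5 (setting)] -/
structure LatticePolarizedK3Fibration {Y B : Motives.SchemeOver ℂ} (π : Y ⟶ B)
    {ι : Type} [Fintype ι] (G : Matrix ι ι ℤ) : Type where
  /-- The total space is a smooth projective threefold. -/
  isSmoothProjective_total : Motives.IsSmoothProjective 3 Y
  /-- The base is a smooth projective curve. -/
  isSmoothProjective_base : Motives.IsSmoothProjective 1 B
  /-- The polarised locus `U ⊆ B(ℂ)`. -/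
  U : Set (Motives.ComplexPoints B)
  /-- `U` is the set of complex points off a proper Zariski-closed subset of `B` … -/
  exists_isClosed : ∃ Z : Set B.left, IsClosed Z ∧ Z ≠ Set.univ ∧ U = {s | s.pt ∉ Z}
  /-- … and has a point (implied by the previous field on the irreducible curve `B`; recorded as
  the anti-vacuity clause). -/
  nonempty_U : U.Nonempty
  /-- The `L`-polarisation of `π` over `U`. -/
  polarization : LatticePolarization π U G

/-! ### DHNT §2.2: the monodromy invariants are the polarisation (named fact) -/

/-- **DHNT 2019, §2.2 eq. (2.3): for a threefold fibred non-isotrivially by `L`-polarised K3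
surfaces whose general fibre has Néron–Severi group `L`, the monodromy invariants of
`H²(X_s(ℂ); ℂ)` are the polarisation `ℒ_s ⊗ ℂ`.** Printed: "`R²π^U_*ℚ = (𝒩𝒮(𝒳^U) ⊕ 𝒯(𝒳^U)) ⊗ ℚ`
… a direct sum of two irreducible `ℚ`-local systems. Here `𝒩𝒮(𝒳^U)` can be interpreted as those
classes which lie in `NS(X_p)` for all `p ∈ U`; by assumption, in our setting `𝒩𝒮(𝒳^U)` is a
trivial local system" — so the invariants are `𝒩𝒮 ⊗ ℚ = ℒ ⊗ ℚ` (`𝒯_ℚ`, irreducible of rank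
`22 − rank L ≥ 2` and non-trivial for a non-isotrivial family, has none; mechanism: theorem of the
fixed part and Torelli). Rendering: the inclusion `invariants s ≤ ℒ_s ⊗ ℂ` for every `s ∈ U`
(the reverse one is `LatticePolarization.span_le_invariants`) under `¬ IsFibrewiseIsotrivialOn`
and `HasGenericNS`; with `HodgeTheory.deligne_globalInvariantCycles` (`Im(H²(Y) → H²(X_s)) =`
invariants) it gives `Im(H²(Y, ℚ) → H²(X_s, ℚ)) = ℒ_s ⊗ ℚ`, `= NS(X_s)_ℚ` exactly at `NS`-generic
fibres. [cite: DoranHarderNovoseltsevThompson2019, §2.2 eq. (2.3) and the paragraph following it]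
[cite: DoranEtAl2015, §2.1 (decomposition R²π_*ℚ = (𝒯 ⊕ 𝒩𝒮) ⊗ ℚ) and §2.2] -/
def DHNT2019_monodromyInvariants_le_span : Prop :=
  ∀ ⦃Y B : Motives.SchemeOver ℂ⦄ (π : Y ⟶ B) ⦃ι : Type⦄ [Fintype ι] (G : Matrix ι ι ℤ)
    (F : LatticePolarizedK3Fibration π G),
    ¬ IsFibrewiseIsotrivialOn π F.U → F.polarization.HasGenericNS →
      ∀ s : F.U, F.polarization.invariants s ≤ F.polarization.span s

/-- Under the §2.2 fact the invariants ARE the polarisation: `H²(X_s)^{π₁} = ℒ_s ⊗ ℂ`.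
[cite: DoranHarderNovoseltsevThompson2019, §2.2 eq. (2.3)] -/
theorem DHNT2019_monodromyInvariants_le_span.invariants_eq (h : DHNT2019_monodromyInvariants_le_span)
    {Y B : Motives.SchemeOver ℂ} {π : Y ⟶ B} {ι : Type} [Fintype ι] {G : Matrix ι ι ℤ}
    (F : LatticePolarizedK3Fibration π G) (hni : ¬ IsFibrewiseIsotrivialOn π F.U)
    (hgen : F.polarization.HasGenericNS) (s : F.U) :
    F.polarization.invariants s = F.polarization.span s :=
  le_antisymm (h π G F hni hgen s) (F.polarization.span_le_invariants s)

/-- Under the §2.2 fact, restrictions of global classes lie in the polarisation: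
`Im(H²(Y(ℂ); ℂ) → H²(X_s(ℂ); ℂ)) ⊆ ℒ_s ⊗ ℂ` for every `s ∈ U`.
[cite: DoranHarderNovoseltsevThompson2019, §2.2 eq. (2.3)] -/
theorem DHNT2019_monodromyInvariants_le_span.map_fiberι_mem_span
    (h : DHNT2019_monodromyInvariants_le_span)
    {Y B : Motives.SchemeOver ℂ} {π : Y ⟶ B} {ι : Type} [Fintype ι] {G : Matrix ι ι ℤ}
    (F : LatticePolarizedK3Fibration π G) (hni : ¬ IsFibrewiseIsotrivialOn π F.U)
    (hgen : F.polarization.HasGenericNS) (s : F.U) (A : HodgeTheory.complexBetti Y (2 * 1)) :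
    HodgeTheory.complexBetti.map (Motives.fiberι π s.1) (2 * 1) A ∈ F.polarization.span s :=
  h π G F hni hgen s (F.polarization.map_fiberι_mem_invariants s A)

end Literature.AlgebraicGeometry.Surfaces

end
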